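import Summits.HodgeConjecture.HodgeConjecture.Theorems.MilnorKExponentialSymbolClassesAlgebraicSymbolClassesHodgeType

/-!
# Route MilnorKExponential — the support item `SymbolClassesHodgeType` (L ⊆ Hdg), closed

The route decl `Theses.MilnorKExponential.SymbolClassesHodgeType` (stmt-HodgeConjecture-17746: a
rational symbol class of weight `q + 1` on a smooth projective complex variety is of Hodge type
`(q+1, q+1)`) is the inlined, unguarded form of the named statement `HodgeTypeNamed` of
`MilnorKExponentialDefs`, which the line `NashDescentSketch` of the crux `SymbolClassesAlgebraic`
proved as its typing stub `MilnorKExponentialNash.stub_symbolClassesHodgeType` (typed Čech–de Rham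
zig-zag inside `F^p`, `∂∂̄`-strictness, reality of rational classes; files
`MilnorKExponentialSymbolClassesAlgebraicSymbolClassesHodgeType{Strictness,Projection,Zigzag,}`).
This file only rebundles the inlined hypothesis into `IsSymbolClass` (the census bridge). No new
definitions, no named facts.
-/

noncomputable section

-- mandated namespace `Summit.HodgeConjecture.HodgeConjecture.…` (single-problem summit) trips dupNamespace
set_option linter.dupNamespace false

namespace Summit.HodgeConjecture.HodgeConjecture.Theorems

/-- **L ⊆ Hdg (route item `SymbolClassesHodgeType`, stmt-HodgeConjecture-17746)**: every rational
symbol class of weight `q + 1` on a smooth projective complex variety is of Hodge type `(q+1, q+1)`.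
Proof: the inlined hypothesis is `IsSymbolClass n X q c` with the `Nontrivial` guard dropped; apply
`MilnorKExponentialNash.stub_symbolClassesHodgeType : HodgeTypeNamed`. -/
theorem symbolClassesHodgeType_proof : Theses.MilnorKExponential.SymbolClassesHodgeType := by
  intro n X hX q c hc hs
  obtain ⟨A, hN, ι, hι, U, hU, hcov, σ, hg, hco, θ, m, hm, hT, hdR⟩ := hs
  exact MilnorKExponentialNash.stub_symbolClassesHodgeType hX q c hc
    ⟨A, fun _ ↦ hN, ι, hι, U, hU, hcov, σ, ⟨hg, hco⟩, θ, m, hm, hT, hdR⟩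

end Summit.HodgeConjecture.HodgeConjecture.Theorems

end
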